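import Summits.QuantumFields.YangMills.Theorems.AlphaInputsT3ACv3NewtonLiftFlatLinearisation
import Summits.QuantumFields.YangMills.Theorems.AlphaInputsT3ACv3EMLTwoFieldIterUniformAllL
import Summits.QuantumFields.YangMills.Theorems.AlphaInputsT3ACv3EMLIterFirstOrderUniformAllL
import HarnessLib

/-!
# `AlphaInputsT3ACv3NewtonLiftFlatLinearisationAllL` — STRATEGY B for 2′, the (FL) row under OWNER RULING g24-№4: **HYPOTHESIS (i) OF THE NEWTON SHELL FOR THE DEFECT MAP, FLAT FRAME,
# AT EVERY BLOCK SIZE `L ≥ 2`** — the `…NewtonLiftFlatLinearisation` row with ★w1's `d + 2 ≤ L` derivative row replaced by ★w5's every-`L` twins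
# (`EMLIterUniformAllL.norm_iter_sub_iter_sub_iterLin_le_uniform_allL`, `norm_iter_sub_one_sub_iterLin_le_uniform_allL`) — so `L = 3`, the record's block size, is covered —
# lane `pub-balaban3d` ∕ cell `ym3-torus`, seat `ym-ust-19936-w4` (g0)

WHY.  Same dressing as `…NewtonLiftFlatLinearisation.norm_mlogDefect_sub_sub_linAvgIterM_le` (two-field exponential, two-field logarithm of the defects, datum near `1`), on the every-`L`
scales `m′(x) = (d+1)L^k x` and the every-`L` constant `C_A = (d+1)·C_S·5200ℓ²∕(L(L−1))` (`C_S = 18^d(2+(d+1)18^d)`, `ℓ = (d+2)L`) of the AllL rows, in the standing range `k ≤ m + K`.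
* ★★ `norm_mlogDefect_sub_sub_linAvgIterM_le_allL` — `‖Φ(a′)(c) − Φ(a)(c) − (Q^{(k)}(a′−a))(c)‖ ≤ (d+1)L^k·[8ρ_D + 2C_A(m′(4r)+m′(2r+η)) + (2r+η) + (2m′(η)+η₀)]·Δ`, `ρ_D = 2m′(2r) + η₀`.
Count-neutral helper toward R3 2′ (items 19936∕19935); `hLift`∕(FL) NOT proved here; registry untouched; nothing about d = 4, the continuum, or a mass gap; YM₃ on T³ is rung R3, not Clay.

References: T. Bałaban, Commun. Math. Phys. 98 (1985) 17–51 [Balaban1985Averaging] (Prop. 4 (134)–(135) p.38, Prop. 5 (156)–(157) p.42, (20)–(23) p.21); CMP 102 (1985) 277–309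
[Balaban1985Variational] ((8), (11)–(15) pp.279–280).
-/

set_option autoImplicit false

noncomputable section

open scoped Matrix.Norms.L2Operator
open NormedSpace

namespace Summit.QuantumFields.YangMills.Theorems.NewtonLiftFlat

open Literature.MathematicalPhysics.QuantumFieldTheory.Balaban1983to89
open Literature.MathematicalPhysics.QuantumFieldTheory.Balaban1983to89.MatrixLog (mlog)
open T4Continuum BlockAveraging ExpMeanLog BlockAveragingEMLLinearised
open Summit.QuantumFields.YangMills.Theorems.LinearLiftMatrix (linAvgIterM linAvgIterM_zero linAvgIterM_succ avgCLM avgCLM_apply norm_linAvgIterM_le CS CS_nonneg)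
open Summit.QuantumFields.YangMills.Theorems.EMLIterUniformAllL (norm_iter_sub_iter_sub_iterLin_le_uniform_allL norm_iter_sub_one_sub_iterLin_le_uniform_allL)
open Summit.QuantumFields.YangMills.Theorems.NewtonDefectMap (norm_mlog_defect_sub_sub_le norm_defect_sub_defect_eq)
open Summit.QuantumFields.YangMills.Theorems.Prop7HolRatioPerStep (coe_star_mul_self coe_mul_star_self)

variable {n : Type*} [Fintype n] [DecidableEq n] [Nonempty n] {P : Params}

set_option maxHeartbeats 1600000 in
/-- **★★ THE (i)-ROW OF THE MODEL NEWTON LIFT AT EVERY `L ≥ 2`** (`k ≤ m + K`); `U₀` a finest `SU(n)` field with `‖U₀,b − 1‖ ≤ η`; `V` a level-`k` field with defect `‖Ū₀^{(k)}(c)V(c)* − 1‖ ≤ η₀`;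
perturbations `a, a′` with `‖a_b‖, ‖a′_b‖ ≤ r ≤ 1/2`, `‖a′_b − a_b‖ ≤ Δ ≤ 2r`, and the perturbed fields `U_a = e^{a}U₀`, `U_{a′} = e^{a′}U₀`; smallness (`m′(x) = (d+1)L^k x`, `C_A = (d+1)C_S·5200ℓ²∕(L(L−1))`):
`C_A(m′(4r) + m′(2r+η)) ≤ 1`, `200ℓ(m′(4r)+m′(2r+η)) ≤ 1`, `4ℓ(m′(4r) + m′(2r+η)) < δ_N`, `ρ_D := 2m′(2r) + η₀ ≤ 1/2`.  Then at every coarse bond `c`: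
`‖log(Ū_{a′}^{(k)}(c)V(c)*) − log(Ū_a^{(k)}(c)V(c)*) − (Q^{(k)}(a′ − a))(c)‖ ≤ (d+1)L^k·[8ρ_D + 2C_A(m′(4r) + m′(2r+η)) + (2r + η) + (2m′(η) + η₀)]·Δ` —
hypothesis (i) of `NewtonShell.exists_zero_in_range_of_approxRightInverse` for `Φ = log(Ū^{(k)}V*)`, `T = avgCLM`, with a Lipschitz constant `(d+1)L^k × (k-free small bracket)`.
[cite: Balaban1985Averaging, Prop. 4 (134)–(135) p.38, Prop. 5 (156)–(157) p.42, (20)–(23) p.21] -/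
theorem norm_mlogDefect_sub_sub_linAvgIterM_le_allL {k : ℕ} (hk : k ≤ P.m + P.K)
    (U₀ Ua Ua' : GaugeField P 0 (Matrix.specialUnitaryGroup n ℂ)) (V : GaugeField P k (Matrix.specialUnitaryGroup n ℂ))
    (a a' : PBond P 0 → Matrix n n ℂ)
    (hUa : ∀ b, ((Ua b : Matrix.specialUnitaryGroup n ℂ) : Matrix n n ℂ) = exp (a b) * (U₀ b : Matrix n n ℂ))
    (hUa' : ∀ b, ((Ua' b : Matrix.specialUnitaryGroup n ℂ) : Matrix n n ℂ) = exp (a' b) * (U₀ b : Matrix n n ℂ))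
    {r η η₀ Δ : ℝ} (hr : r ≤ 1 / 2) (hη : 0 ≤ η) (hη₀ : 0 ≤ η₀) (hΔr : Δ ≤ 2 * r)
    (ha : ∀ b, ‖a b‖ ≤ r) (ha' : ∀ b, ‖a' b‖ ≤ r) (hΔ : ∀ b, ‖a' b - a b‖ ≤ Δ)
    (hU₀ : ∀ b, ‖((U₀ b : Matrix.specialUnitaryGroup n ℂ) : Matrix n n ℂ) - 1‖ ≤ η)
    (hV : ∀ c : PBond P k, ‖((Averaging.iter (fun i => blockAvg (P := P) (j := i) (expMeanLogSU (n := n))) k U₀ c : Matrix.specialUnitaryGroup n ℂ) : Matrix n n ℂ) *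
        star ((V c : Matrix.specialUnitaryGroup n ℂ) : Matrix n n ℂ) - 1‖ ≤ η₀)
    (h5200 : (((P.d : ℝ) + 1) * ((18 : ℝ) ^ P.d * (2 + ((P.d : ℝ) + 1) * (18 : ℝ) ^ P.d)) * (5200 * (((P.d + 2) * P.L : ℕ) : ℝ) ^ 2) / ((P.L : ℝ) * ((P.L : ℝ) - 1))) *
      ((((P.d : ℝ) + 1) * (P.L : ℝ) ^ k * (4 * r)) + (((P.d : ℝ) + 1) * (P.L : ℝ) ^ k * (2 * r + η))) ≤ 1)
    (h200 : 200 * (((P.d + 2) * P.L : ℕ) : ℝ) * ((((P.d : ℝ) + 1) * (P.L : ℝ) ^ k * (4 * r)) + (((P.d : ℝ) + 1) * (P.L : ℝ) ^ k * (2 * r + η))) ≤ 1)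
    (hN : 4 * (((P.d + 2) * P.L : ℕ) : ℝ) *
      ((((P.d : ℝ) + 1) * (P.L : ℝ) ^ k * (4 * r)) + (((P.d : ℝ) + 1) * (P.L : ℝ) ^ k * (2 * r + η))) < deltaSU n)
    (hρD : 2 * ((((P.d : ℝ) + 1) * (P.L : ℝ) ^ k * (2 * r))) + η₀ ≤ 1 / 2) (c : PBond P k) :
    ‖mlog (((Averaging.iter (fun i => blockAvg (P := P) (j := i) (expMeanLogSU (n := n))) k Ua' c : Matrix.specialUnitaryGroup n ℂ) : Matrix n n ℂ) *
          star ((V c : Matrix.specialUnitaryGroup n ℂ) : Matrix n n ℂ)) -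
        mlog (((Averaging.iter (fun i => blockAvg (P := P) (j := i) (expMeanLogSU (n := n))) k Ua c : Matrix.specialUnitaryGroup n ℂ) : Matrix n n ℂ) *
          star ((V c : Matrix.specialUnitaryGroup n ℂ) : Matrix n n ℂ)) -
        linAvgIterM k (fun b => a' b - a b) c‖ ≤
      (((P.d : ℝ) + 1) * (P.L : ℝ) ^ k) *
        (8 * (2 * ((((P.d : ℝ) + 1) * (P.L : ℝ) ^ k * (2 * r))) + η₀) +
          2 * (((P.d : ℝ) + 1) * ((18 : ℝ) ^ P.d * (2 + ((P.d : ℝ) + 1) * (18 : ℝ) ^ P.d)) * (5200 * (((P.d + 2) * P.L : ℕ) : ℝ) ^ 2) / ((P.L : ℝ) * ((P.L : ℝ) - 1))) *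
            ((((P.d : ℝ) + 1) * (P.L : ℝ) ^ k * (4 * r)) + (((P.d : ℝ) + 1) * (P.L : ℝ) ^ k * (2 * r + η))) +
          (2 * r + η) + (2 * ((((P.d : ℝ) + 1) * (P.L : ℝ) ^ k * η)) + η₀)) * Δ := by
  -- letters
  let m : ℝ → ℝ := fun x => (((P.d : ℝ) + 1) * (P.L : ℝ) ^ k * x)
  have hm_def : ∀ x, m x = (((P.d : ℝ) + 1) * (P.L : ℝ) ^ k * x) := fun x => rfl
  set A : ℝ := ((P.d : ℝ) + 1) * (P.L : ℝ) ^ k with hA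
  have hA0 : 0 ≤ A := by positivity
  have hm_mono : ∀ {x y : ℝ}, x ≤ y → m x ≤ m y := fun hxy => by
    rw [hm_def, hm_def]; exact mul_le_mul_of_nonneg_left hxy hA0
  have hm0 : ∀ {x : ℝ}, 0 ≤ x → 0 ≤ m x := fun hx => by rw [hm_def]; positivity
  have hm_lin : ∀ x, m x = A * x := fun x => by rw [hm_def, hA]
  have hr0 : 0 ≤ r := (norm_nonneg _).trans (ha ⟨fun _ => 0, c.dir⟩)
  have hr1 : r ≤ 1 := hr.trans (by norm_num)
  have hΔ0 : 0 ≤ Δ := (norm_nonneg _).trans (hΔ ⟨fun _ => 0, c.dir⟩)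
  have hL1 : (1 : ℝ) < P.L := by exact_mod_cast P.hL.2
  have hLL : 0 < (P.L : ℝ) * ((P.L : ℝ) - 1) := mul_pos (by linarith) (by linarith)
  set CA : ℝ := (((P.d : ℝ) + 1) * ((18 : ℝ) ^ P.d * (2 + ((P.d : ℝ) + 1) * (18 : ℝ) ^ P.d)) * (5200 * (((P.d + 2) * P.L : ℕ) : ℝ) ^ 2) / ((P.L : ℝ) * ((P.L : ℝ) - 1))) with hCA
  have hC5200 : 0 ≤ CA := by rw [hCA]; exact div_nonneg (by positivity) hLL.le
  set C3 : ℝ := (((P.d : ℝ) + 1) * ((18 : ℝ) ^ P.d * (2 + ((P.d : ℝ) + 1) * (18 : ℝ) ^ P.d)) * (324 * (((P.d + 2) * P.L : ℕ) : ℝ) ^ 2) / ((P.L : ℝ) * ((P.L : ℝ) - 1))) with hC3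
  have hC3le : C3 ≤ CA := by
    rw [hC3, hCA]; exact div_le_div_of_nonneg_right (by gcongr; norm_num) hLL.le
  have h200ℓ : 0 ≤ 200 * (((P.d + 2) * P.L : ℕ) : ℝ) := by positivity
  have hℓ0 : 0 ≤ 4 * (((P.d + 2) * P.L : ℕ) : ℝ) := by positivity
  -- the averaging family and the `Q`-family
  set av : (i : ℕ) → Averaging P i (Matrix.specialUnitaryGroup n ℂ) := fun i => blockAvg (P := P) (j := i) (expMeanLogSU (n := n)) with hav
  have hQ0 : ∀ Y : PBond P 0 → Matrix n n ℂ, linAvgIterM 0 Y = Y := fun Y => linAvgIterM_zero Y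
  have hQs : ∀ (i : ℕ) (Y : PBond P 0 → Matrix n n ℂ) (c : PBond P (i + 1)), linAvgIterM (i + 1) Y c = linAvg (linAvgIterM i Y) c :=
    fun i Y c => linAvgIterM_succ i Y c
  -- field sizes
  have hUa_one : ∀ b, ‖((Ua b : Matrix.specialUnitaryGroup n ℂ) : Matrix n n ℂ) - 1‖ ≤ 2 * r + η := fun b => by
    rw [hUa b]; exact norm_expField_sub_one_le (U₀ b) (a b) hr1 (ha b) (hU₀ b)
  have hUa_U₀ : ∀ b, ‖((Ua b : Matrix.specialUnitaryGroup n ℂ) : Matrix n n ℂ) - ((U₀ b : Matrix.specialUnitaryGroup n ℂ) : Matrix n n ℂ)‖ ≤ 2 * r := fun b => by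
    rw [hUa b]; exact norm_expField_sub_field_le (U₀ b) (a b) hr1 (ha b)
  have hUa'_U₀ : ∀ b, ‖((Ua' b : Matrix.specialUnitaryGroup n ℂ) : Matrix n n ℂ) - ((U₀ b : Matrix.specialUnitaryGroup n ℂ) : Matrix n n ℂ)‖ ≤ 2 * r := fun b => by
    rw [hUa' b]; exact norm_expField_sub_field_le (U₀ b) (a' b) hr1 (ha' b)
  have hUU : ∀ b, ‖((Ua' b : Matrix.specialUnitaryGroup n ℂ) : Matrix n n ℂ) - ((Ua b : Matrix.specialUnitaryGroup n ℂ) : Matrix n n ℂ)‖ ≤ 2 * Δ := fun b => by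
    rw [hUa b, hUa' b]; exact (norm_expField_sub_expField_le (U₀ b) (a b) (a' b) hr (ha b) (ha' b)).trans (by linarith [hΔ b])
  have hRest : ∀ b, ‖((Ua' b : Matrix.specialUnitaryGroup n ℂ) : Matrix n n ℂ) - ((Ua b : Matrix.specialUnitaryGroup n ℂ) : Matrix n n ℂ) - (a' b - a b)‖ ≤ (2 * r + η) * Δ :=
    fun b => by
      rw [hUa b, hUa' b]
      refine (norm_expField_rest_le (U₀ b) (a b) (a' b) hr (ha b) (ha' b) (hU₀ b)).trans ?_
      exact mul_le_mul_of_nonneg_left (hΔ b) (by positivity)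
  -- smallness in the shapes of R1∕R3
  have h2Δ : m (2 * Δ) ≤ m (4 * r) := hm_mono (by linarith)
  have h2r : m (2 * r) ≤ m (4 * r) := hm_mono (by linarith)
  have hηm : m η ≤ m (2 * r + η) := hm_mono (by linarith)
  have hsum_nn : 0 ≤ m (4 * r) + m (2 * r + η) := add_nonneg (hm0 (by positivity)) (hm0 (by positivity))
  -- (1) `‖W₀ − 1‖ ≤ 2m(η)` (R1)
  have hR1 := norm_iter_sub_one_sub_iterLin_le_uniform_allL linAvgIterM hQ0 hQs U₀ hη hU₀ k hk
    (by
      have : C3 * m η ≤ CA * (m (4 * r) + m (2 * r + η)) :=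
        mul_le_mul hC3le (hηm.trans (le_add_of_nonneg_left (hm0 (by positivity)))) (hm0 hη) hC5200
      exact this.trans h5200)
    (by
      have : 32 * (((P.d + 2) * P.L : ℕ) : ℝ) * m η ≤ 200 * (((P.d + 2) * P.L : ℕ) : ℝ) * (m (4 * r) + m (2 * r + η)) :=
        mul_le_mul (by gcongr; norm_num) (hηm.trans (le_add_of_nonneg_left (hm0 (by positivity)))) (hm0 hη) h200ℓ
      exact this.trans h200)
    (by
      have : 4 * (((P.d + 2) * P.L : ℕ) : ℝ) * m η ≤ 4 * (((P.d + 2) * P.L : ℕ) : ℝ) * (m (4 * r) + m (2 * r + η)) :=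
        mul_le_mul_of_nonneg_left (hηm.trans (le_add_of_nonneg_left (hm0 (by positivity)))) hℓ0
      exact lt_of_le_of_lt this hN)
  obtain ⟨hW₀, -⟩ := hR1 k le_rfl c
  -- (2) the datum is near `1`
  have hv := norm_datum_sub_one_le _ (V c) (hV c) hW₀
  -- (3) `‖W − W₀‖, ‖W′ − W₀‖ ≤ 2m(2r)` (R3 against the start)
  have hR3_0 : ∀ (Ub : GaugeField P 0 (Matrix.specialUnitaryGroup n ℂ)),
      (∀ b, ‖((Ub b : Matrix.specialUnitaryGroup n ℂ) : Matrix n n ℂ) - ((U₀ b : Matrix.specialUnitaryGroup n ℂ) : Matrix n n ℂ)‖ ≤ 2 * r) →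
      ‖((Averaging.iter av k Ub c : Matrix.specialUnitaryGroup n ℂ) : Matrix n n ℂ) - ((Averaging.iter av k U₀ c : Matrix.specialUnitaryGroup n ℂ) : Matrix n n ℂ)‖ ≤ 2 * m (2 * r) := by
    intro Ub hUb
    have h := norm_iter_sub_iter_sub_iterLin_le_uniform_allL linAvgIterM hQ0 hQs Ub U₀ hη (by positivity) hU₀ hUb k hk
      (by
        have : C3 * m η ≤ CA * (m (4 * r) + m (2 * r + η)) :=
          mul_le_mul hC3le (hηm.trans (le_add_of_nonneg_left (hm0 (by positivity)))) (hm0 hη) hC5200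
        exact this.trans h5200)
      (by
        have : 200 * (((P.d + 2) * P.L : ℕ) : ℝ) * (m (2 * r) + m η) ≤ 200 * (((P.d + 2) * P.L : ℕ) : ℝ) * (m (4 * r) + m (2 * r + η)) :=
          mul_le_mul_of_nonneg_left (add_le_add h2r hηm) h200ℓ
        exact this.trans h200)
      (by
        have : CA * (m (2 * r) + m η) ≤ CA * (m (4 * r) + m (2 * r + η)) := mul_le_mul_of_nonneg_left (add_le_add h2r hηm) hC5200
        exact this.trans h5200)
      (by
        have : 4 * (((P.d + 2) * P.L : ℕ) : ℝ) * (m (2 * r) + m η) ≤ 4 * (((P.d + 2) * P.L : ℕ) : ℝ) * (m (4 * r) + m (2 * r + η)) :=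
          mul_le_mul_of_nonneg_left (add_le_add h2r hηm) hℓ0
        exact lt_of_le_of_lt this hN)
    exact (h k le_rfl c).1
  have hW_W₀ := hR3_0 Ua hUa_U₀
  have hW'_W₀ := hR3_0 Ua' hUa'_U₀
  -- names
  set W₀ := ((Averaging.iter av k U₀ c : Matrix.specialUnitaryGroup n ℂ) : Matrix n n ℂ) with hW₀def
  set W := ((Averaging.iter av k Ua c : Matrix.specialUnitaryGroup n ℂ) : Matrix n n ℂ) with hWdef
  set W' := ((Averaging.iter av k Ua' c : Matrix.specialUnitaryGroup n ℂ) : Matrix n n ℂ) with hW'def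
  set sV := star ((V c : Matrix.specialUnitaryGroup n ℂ) : Matrix n n ℂ) with hsV
  -- (4) both defects are `ρ_D`-close to `1`
  have hdef : ∀ (X : Matrix n n ℂ), ‖X - W₀‖ ≤ 2 * m (2 * r) → ‖X * sV - 1‖ ≤ 2 * m (2 * r) + η₀ := by
    intro X hX
    have e : X * sV - 1 = (X - W₀) * sV + (W₀ * sV - 1) := by noncomm_ring
    rw [e]
    calc _ ≤ ‖(X - W₀) * sV‖ + ‖W₀ * sV - 1‖ := norm_add_le _ _
      _ ≤ 2 * m (2 * r) + η₀ := by rw [hsV, CStarRing.norm_mul_mem_unitary _ (Unitary.star_mem (V c).2.1)]; exact add_le_add hX (hV c)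
  have hD := hdef W hW_W₀
  have hD' := hdef W' hW'_W₀
  have hρD1 : 2 * m (2 * r) + η₀ < 1 := lt_of_le_of_lt hρD (by norm_num)
  -- (5) R3 for the pair `(U_{a′}, U_a)`
  have hR3 := norm_iter_sub_iter_sub_iterLin_le_uniform_allL linAvgIterM hQ0 hQs Ua' Ua (by positivity) (by positivity) hUa_one hUU k hk
    (by
      have : C3 * m (2 * r + η) ≤ CA * (m (4 * r) + m (2 * r + η)) :=
        mul_le_mul hC3le (le_add_of_nonneg_left (hm0 (by positivity))) (hm0 (by positivity)) hC5200
      exact this.trans h5200)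
    (by
      have : 200 * (((P.d + 2) * P.L : ℕ) : ℝ) * (m (2 * Δ) + m (2 * r + η)) ≤ 200 * (((P.d + 2) * P.L : ℕ) : ℝ) * (m (4 * r) + m (2 * r + η)) :=
        mul_le_mul_of_nonneg_left (add_le_add h2Δ le_rfl) h200ℓ
      exact this.trans h200)
    (by
      have : CA * (m (2 * Δ) + m (2 * r + η)) ≤ CA * (m (4 * r) + m (2 * r + η)) := mul_le_mul_of_nonneg_left (add_le_add h2Δ le_rfl) hC5200
      exact this.trans h5200)
    (by
      have : 4 * (((P.d + 2) * P.L : ℕ) : ℝ) * (m (2 * Δ) + m (2 * r + η)) ≤ 4 * (((P.d + 2) * P.L : ℕ) : ℝ) * (m (4 * r) + m (2 * r + η)) :=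
        mul_le_mul_of_nonneg_left (add_le_add h2Δ le_rfl) hℓ0
      exact lt_of_le_of_lt this hN)
  obtain ⟨hWW, hWWQ⟩ := hR3 k le_rfl c
  -- the `Q`-terms
  set Z : PBond P 0 → Matrix n n ℂ := fun b => ((Ua' b : Matrix.specialUnitaryGroup n ℂ) : Matrix n n ℂ) - ((Ua b : Matrix.specialUnitaryGroup n ℂ) : Matrix n n ℂ) with hZ
  set Rest : PBond P 0 → Matrix n n ℂ := fun b => Z b - (a' b - a b) with hRestdef
  set X := linAvgIterM k (fun b => a' b - a b) c with hX
  have hlin : linAvgIterM k Z c = X + linAvgIterM k Rest c := by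
    have hZsplit : Z = (fun b => a' b - a b) + Rest := by funext b; simp [hRestdef]
    rw [hZsplit, hX, ← avgCLM_apply k, ← avgCLM_apply k, ← avgCLM_apply k, map_add]
    rfl
  have hXn : ‖X‖ ≤ A * Δ := by rw [hX, hA]; exact norm_linAvgIterM_le k _ hΔ c
  have hLRest : ‖linAvgIterM k Rest c‖ ≤ A * ((2 * r + η) * Δ) := by rw [hA]; exact norm_linAvgIterM_le k _ (fun b => hRest b) c
  -- (7) the two-field logarithm
  have hlog := norm_mlog_defect_sub_sub_le W' W (V c) hρD1 hD' hD
  have hfrac : (2 * m (2 * r) + η₀) / (1 - (2 * m (2 * r) + η₀)) ≤ 2 * (2 * m (2 * r) + η₀) := by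
    rw [div_le_iff₀ (by linarith)]
    have h0 : 0 ≤ 2 * m (2 * r) + η₀ := add_nonneg (by have := hm0 (show (0:ℝ) ≤ 2 * r by positivity); linarith) hη₀
    nlinarith
  -- (8) the datum factor
  have hXV : ‖X * sV - X‖ ≤ (A * Δ) * (2 * m η + η₀) := by
    have e : X * sV - X = X * (sV - 1) := by noncomm_ring
    rw [e]
    refine (norm_mul_le _ _).trans (mul_le_mul hXn ?_ (norm_nonneg _) (by positivity))
    have hs : star ((V c : Matrix.specialUnitaryGroup n ℂ) : Matrix n n ℂ) - 1 = star (((V c : Matrix.specialUnitaryGroup n ℂ) : Matrix n n ℂ) - 1) := by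
      rw [star_sub, star_one]
    rw [hsV, hs, norm_star]
    exact hv
  -- (9) assembly
  have e : mlog (W' * sV) - mlog (W * sV) - X =
      (mlog (W' * sV) - mlog (W * sV) - (W' - W) * sV) + ((W' - W) - linAvgIterM k Z c) * sV + linAvgIterM k Rest c * sV + (X * sV - X) := by
    rw [hlin]; noncomm_ring
  rw [e]
  have hsVn : ∀ Y : Matrix n n ℂ, ‖Y * sV‖ = ‖Y‖ := fun Y => by rw [hsV, CStarRing.norm_mul_mem_unitary _ (Unitary.star_mem (V c).2.1)]
  have t1 : ‖mlog (W' * sV) - mlog (W * sV) - (W' - W) * sV‖ ≤ 2 * (2 * m (2 * r) + η₀) * (2 * m (2 * Δ)) :=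
    hlog.trans (mul_le_mul hfrac hWW (norm_nonneg _) (by positivity))
  have t2 : ‖((W' - W) - linAvgIterM k Z c) * sV‖ ≤ CA * (m (2 * Δ) * (m (2 * Δ) + m (2 * r + η))) := by
    rw [hsVn]; exact hWWQ
  have t3 : ‖linAvgIterM k Rest c * sV‖ ≤ A * ((2 * r + η) * Δ) := by rw [hsVn]; exact hLRest
  have hm2Δ : m (2 * Δ) = A * (2 * Δ) := hm_lin _
  calc _ ≤ ‖mlog (W' * sV) - mlog (W * sV) - (W' - W) * sV‖ + ‖((W' - W) - linAvgIterM k Z c) * sV‖ + ‖linAvgIterM k Rest c * sV‖ + ‖X * sV - X‖ := by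
        refine (norm_add_le _ _).trans (add_le_add ((norm_add_le _ _).trans (add_le_add (norm_add_le _ _) le_rfl)) le_rfl)
    _ ≤ 2 * (2 * m (2 * r) + η₀) * (2 * m (2 * Δ)) + CA * (m (2 * Δ) * (m (2 * Δ) + m (2 * r + η))) +
          A * ((2 * r + η) * Δ) + (A * Δ) * (2 * m η + η₀) := add_le_add (add_le_add (add_le_add t1 t2) t3) hXV
    _ ≤ A * (8 * (2 * m (2 * r) + η₀) + 2 * CA * (m (4 * r) + m (2 * r + η)) + (2 * r + η) + (2 * m η + η₀)) * Δ := by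
        rw [hm2Δ]
        have hρ0 : 0 ≤ 2 * m (2 * r) + η₀ := add_nonneg (by have := hm0 (show (0:ℝ) ≤ 2 * r by positivity); linarith) hη₀
        have hq : A * (2 * Δ) + m (2 * r + η) ≤ m (4 * r) + m (2 * r + η) := by rw [← hm2Δ]; exact add_le_add h2Δ le_rfl
        have hineq : CA * (A * (2 * Δ) * (A * (2 * Δ) + m (2 * r + η))) ≤ CA * (A * (2 * Δ) * (m (4 * r) + m (2 * r + η))) :=
          mul_le_mul_of_nonneg_left (mul_le_mul_of_nonneg_left hq (by positivity)) hC5200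
        nlinarith [hineq, hρ0, hsum_nn, hA0, hΔ0, mul_nonneg hA0 hΔ0, hC5200]
    _ = _ := by rw [hm_def, hm_def, hm_def, hm_def, hA, hCA]

end Summit.QuantumFields.YangMills.Theorems.NewtonLiftFlat

end
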